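import Summits.AtomisticToContinuum.Crystallization.Theorems.PalmUnimodularRigidityLayeredLawsSelectHcpCertificateDefs
import Mathlib.Analysis.InnerProductSpace.Spectrum

/-!
# Crux `LayeredLawsSelectHcp` (stmt-AtomisticToContinuum-9226), line `mtp-prestress-split-ergodic-frame`:
# rotation rigidity and the frame difference of two frames (tools for `tube_adjacentFrames`, G3b)

The far field of the certificate (`Cruxes/LayeredLawsSelectHcp/LeadC3FarField.md`, §5, §7(b)) reads bond vectors along
label paths in the frames of consecutive atoms; consecutive frames `(a, A)`, `(a', A')` (scale times linear isometry,
with a parity sign `s = ±1`) are compared through their FRAME DIFFERENCE `v ↦ a • A v − s • (a' • A' v)`, which the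
shared atoms control on finitely many vectors.  This file turns control on an orthogonal triple into control on all of
the space with the constant `½` of rotations rather than the constant `1` of general linear maps:

* **Rotation rigidity** (`norm_sub_isometry_sq_le`, in any real inner product space of dimension `3`): for a linear
  isometry `R` and an orthonormal triple `e` with `∑ ‖eⱼ − R eⱼ‖² < 4` (this excludes the improper isometries),
  `‖x − R x‖² ≤ ½ (∑ ‖eⱼ − R eⱼ‖²) ‖x‖²` — the form `‖x − Rx‖²` of a rotation by `θ` has eigenvalues
  `0, 2 − 2cos θ, 2 − 2cos θ`, so its top eigenvalue is HALF its trace.  Proof without an axis: in an orthonormal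
  eigenbasis `b` of the symmetric operator `S = R + R⁻¹` (spectral theorem) the matrix `Cᵢⱼ = ⟪bⱼ, R bᵢ⟫` has unit rows
  and `μᵢ = 2Cᵢᵢ`; `S (R bᵢ) = μᵢ R bᵢ` gives `(Cⱼⱼ − Cᵢᵢ) Cᵢⱼ = 0`, and with the trace condition each `2 − μᵢ` is at
  most the sum of the other two (`diag_le_of_row`).
* Scaled and applied to two frames (`norm_sub_smul_isometry_sq_le`, `two_frames_sq_le`, the registered anchor
  `tube_frameRigidity`, and `two_frames_sq_le_of_orthogonal` for an orthogonal rather than orthonormal triple):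
  `‖a A x − s a' A' x‖² ≤ ½ (∑ ‖a A fⱼ − s a' A' fⱼ‖² / ‖fⱼ‖²) ‖x‖²` whenever the right-hand sum is `< 4 a a'`.
* The elementary read-backs of the shared atoms: a bond gives `‖a A p − s a' A' p‖ ≤ (a + a')/100`
  (`frame_le_of_near`), a common neighbour `‖a A (q − p) − s a' A' (q − p)‖ ≤ (2a + a')/100`
  (`frame_sub_le_of_near`), and the bond length gives `|a − a'| ≤ (a + a')/100` (`abs_sub_le_of_near`).

All `[folklore]`.
-/

noncomputable section

namespace Summit.AtomisticToContinuum.Crystallization.Theorems.PalmUnimodularRigidity.LayeredLawsSelectHcp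

open MeasureTheory Set
open Literature.MathematicalPhysics.StatisticalMechanics Literature.Geometry.DiscreteGeometry
open scoped RealInnerProductSpace

variable {E : Type*} [NormedAddCommGroup E] [InnerProductSpace ℝ E]

/-! ## Rotation rigidity: the top eigenvalue of `‖x − Rx‖²` is half its trace -/

/-- Arithmetic core of the rotation rigidity: a unit row `(c₀₀, c₀₁, c₀₂)` of a matrix with diagonal entries `≤ 1`,
`(cⱼⱼ − c₀₀) c₀ⱼ = 0` and trace `> 1` has `c₁₁ + c₂₂ ≤ 1 + c₀₀`. [folklore] -/
theorem diag_le_of_row (c₀₀ c₁₁ c₂₂ c₀₁ c₀₂ : ℝ) (h1 : c₀₀ ^ 2 + c₀₁ ^ 2 + c₀₂ ^ 2 = 1) (h₁₁ : c₁₁ ≤ 1)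
    (h₂₂ : c₂₂ ≤ 1) (hA : (c₁₁ - c₀₀) * c₀₁ = 0) (hB : (c₂₂ - c₀₀) * c₀₂ = 0)
    (htr : 1 < c₀₀ + c₁₁ + c₂₂) : c₁₁ + c₂₂ ≤ 1 + c₀₀ := by
  rcases mul_eq_zero.1 hA with h | h
  · linarith
  rcases mul_eq_zero.1 hB with h' | h'
  · linarith
  rw [h, h'] at h1
  nlinarith

/-- **Rotation rigidity.** In a real inner product space of dimension `3`, for a linear isometry `R` and an orthonormal
triple `e` with `∑ⱼ ‖eⱼ − R eⱼ‖² < 4` (which excludes the improper isometries),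
`‖x − R x‖² ≤ ½ (∑ⱼ ‖eⱼ − R eⱼ‖²) ‖x‖²` for all `x`: the quadratic form `‖x − Rx‖²` of a rotation has eigenvalues
`0, t, t`, so its largest eigenvalue is half its trace.  In an orthonormal eigenbasis `b` of the symmetric operator
`S = R + R⁻¹` the matrix `Cᵢⱼ = ⟪bⱼ, R bᵢ⟫` has unit rows and `μᵢ = 2 Cᵢᵢ`; `S (R bᵢ) = μᵢ R bᵢ` gives
`(Cⱼⱼ − Cᵢᵢ) Cᵢⱼ = 0`, whence each `2 − μᵢ` is at most the sum of the other two (`diag_le_of_row`). [folklore] -/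
theorem norm_sub_isometry_sq_le (hn : Module.finrank ℝ E = 3) (R : E ≃ₗᵢ[ℝ] E) {e : Fin 3 → E}
    (he : Orthonormal ℝ e) (h4 : ∑ j, ‖e j - R (e j)‖ ^ 2 < 4) (x : E) :
    ‖x - R x‖ ^ 2 ≤ (1 / 2) * (∑ j, ‖e j - R (e j)‖ ^ 2) * ‖x‖ ^ 2 := by
  haveI : FiniteDimensional ℝ E := Module.finite_of_finrank_pos (by rw [hn]; norm_num)
  -- the symmetric operator `S = R + R⁻¹` and an orthonormal eigenbasis
  set S : E →ₗ[ℝ] E := (R.toLinearEquiv : E →ₗ[ℝ] E) + (R.symm.toLinearEquiv : E →ₗ[ℝ] E) with hSdef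
  have hS_apply : ∀ v, S v = R v + R.symm v := fun v => by simp [hSdef]
  have hS : S.IsSymmetric := by
    intro v w
    rw [hS_apply, hS_apply, inner_add_left, inner_add_right, LinearIsometryEquiv.inner_map_eq_flip,
      LinearIsometryEquiv.inner_map_eq_flip R.symm, LinearIsometryEquiv.symm_symm, add_comm]
  set b := hS.eigenvectorBasis hn with hbdef
  set μ := hS.eigenvalues hn with hμdef
  have hSb : ∀ i, S (b i) = μ i • b i := fun i => by
    rw [hbdef, hμdef, hS.apply_eigenvectorBasis hn i]; rfl
  have hbb : ∀ i, ⟪b i, b i⟫ = 1 := fun i => by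
    rw [real_inner_self_eq_norm_sq, b.orthonormal.1 i, one_pow]
  -- the quadratic form `‖v − Rv‖² = 2‖v‖² − ⟪v, S v⟫`
  have hq : ∀ v, ‖v - R v‖ ^ 2 = 2 * ‖v‖ ^ 2 - ⟪v, S v⟫ := by
    intro v
    rw [norm_sub_sq_real, LinearIsometryEquiv.norm_map, hS_apply, inner_add_right,
      ← R.inner_map_map v (R.symm v), R.apply_symm_apply, real_inner_comm (R v) v]
    ring
  -- matrix entries of `R` in the eigenbasis
  set C : Fin 3 → Fin 3 → ℝ := fun i j => ⟪b j, R (b i)⟫ with hCdef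
  have hμC : ∀ i, μ i = 2 * C i i := by
    intro i
    have h1 : ⟪b i, S (b i)⟫ = μ i := by rw [hSb, real_inner_smul_right, hbb, mul_one]
    have h2 := hq (b i)
    rw [norm_sub_sq_real, LinearIsometryEquiv.norm_map, b.orthonormal.1 i, h1] at h2
    simp only [hCdef]
    linarith
  have hrow : ∀ i, ∑ j, C i j ^ 2 = 1 := by
    intro i
    have h := b.sum_inner_mul_inner (R (b i)) (R (b i))
    rw [real_inner_self_eq_norm_sq, LinearIsometryEquiv.norm_map, b.orthonormal.1 i, one_pow] at h
    rw [← h]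
    refine Finset.sum_congr rfl fun j _ => ?_
    simp only [hCdef]
    rw [real_inner_comm (b j) (R (b i)), sq]
  have hdiag : ∀ i, C i i ≤ 1 := by
    intro i
    have h : C i i ^ 2 ≤ ∑ j, C i j ^ 2 :=
      Finset.single_le_sum (f := fun j => C i j ^ 2) (fun j _ => sq_nonneg _) (Finset.mem_univ i)
    rw [hrow] at h
    nlinarith
  have hkey : ∀ i j, (C j j - C i i) * C i j = 0 := by
    intro i j
    have hSy : S (R (b i)) = μ i • R (b i) := by
      have h := congrArg R (hSb i)
      rw [hS_apply, map_add, LinearIsometryEquiv.apply_symm_apply, map_smul] at h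
      rw [hS_apply, LinearIsometryEquiv.symm_apply_apply]
      exact h
    have h1 : ⟪S (b j), R (b i)⟫ = ⟪b j, S (R (b i))⟫ := hS (b j) (R (b i))
    rw [hSb, hSy, real_inner_smul_left, real_inner_smul_right, hμC, hμC] at h1
    simp only [hCdef]
    linear_combination h1 / 2
  -- expansion of the quadratic form in the eigenbasis
  have hqx : ∀ v, ‖v - R v‖ ^ 2 = ∑ i, (2 - μ i) * ⟪b i, v⟫ ^ 2 := by
    intro v
    have hP : ∑ i, ⟪v, b i⟫ * ⟪b i, v⟫ = ‖v‖ ^ 2 := by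
      rw [b.sum_inner_mul_inner, real_inner_self_eq_norm_sq]
    have hPS : ∑ i, ⟪v, b i⟫ * ⟪b i, S v⟫ = ⟪v, S v⟫ := b.sum_inner_mul_inner v (S v)
    have hbS : ∀ i, ⟪b i, S v⟫ = μ i * ⟪b i, v⟫ := fun i => by
      rw [← hS (b i) v, hSb, real_inner_smul_left]
    rw [hq, ← hP, ← hPS, Finset.mul_sum, ← Finset.sum_sub_distrib]
    refine Finset.sum_congr rfl fun i _ => ?_
    rw [hbS, ← real_inner_comm (b i) v]
    ring
  have hP : ∀ v, ∑ i, ⟪b i, v⟫ ^ 2 = ‖v‖ ^ 2 := by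
    intro v
    rw [← real_inner_self_eq_norm_sq, ← b.sum_inner_mul_inner v v]
    refine Finset.sum_congr rfl fun i _ => ?_
    rw [real_inner_comm (b i) v, sq]
  -- the trace: `∑ⱼ ‖eⱼ − R eⱼ‖² = ∑ᵢ (2 − μᵢ)` (Parseval in the basis `e`)
  have hsp : ⊤ ≤ Submodule.span ℝ (Set.range e) :=
    (he.linearIndependent.span_eq_top_of_card_eq_finrank' (by rw [hn, Fintype.card_fin])).ge
  set Be := OrthonormalBasis.mk he hsp with hBe
  have hBe_apply : ∀ j, Be j = e j := fun j => by rw [hBe, OrthonormalBasis.coe_mk]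
  have htrace : ∑ j, ‖e j - R (e j)‖ ^ 2 = ∑ i, (2 - μ i) := by
    simp_rw [hqx]
    rw [Finset.sum_comm]
    refine Finset.sum_congr rfl fun i _ => ?_
    rw [← Finset.mul_sum]
    have h : ∑ j, ⟪b i, e j⟫ ^ 2 = 1 := by
      rw [← hbb i, ← Be.sum_inner_mul_inner (b i) (b i)]
      refine Finset.sum_congr rfl fun j _ => ?_
      rw [hBe_apply, real_inner_comm (e j) (b i), sq]
    rw [h, mul_one]
  -- each eigenvalue of the form is at most half the trace
  have htr1 : 1 < C 0 0 + C 1 1 + C 2 2 := by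
    rw [htrace, Fin.sum_univ_three, hμC, hμC, hμC] at h4
    linarith
  have hr : ∀ i, C i 0 ^ 2 + C i 1 ^ 2 + C i 2 ^ 2 = 1 := fun i => by
    rw [← hrow i, Fin.sum_univ_three]
  have hle : ∀ i, 2 - μ i ≤ (1 / 2) * ∑ k, (2 - μ k) := by
    intro i
    rw [Fin.sum_univ_three, hμC, hμC, hμC, hμC]
    fin_cases i
    · have := diag_le_of_row (C 0 0) (C 1 1) (C 2 2) (C 0 1) (C 0 2) (hr 0) (hdiag 1) (hdiag 2)
        (hkey 0 1) (hkey 0 2) htr1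
      simp only [Fin.zero_eta]
      linarith
    · have := diag_le_of_row (C 1 1) (C 0 0) (C 2 2) (C 1 0) (C 1 2) (by linarith [hr 1]) (hdiag 0)
        (hdiag 2) (hkey 1 0) (hkey 1 2) (by linarith)
      simp only [Fin.mk_one]
      linarith
    · have := diag_le_of_row (C 2 2) (C 0 0) (C 1 1) (C 2 0) (C 2 1) (by linarith [hr 2]) (hdiag 0)
        (hdiag 1) (hkey 2 0) (hkey 2 1) (by linarith)
      simp only [Fin.reduceFinMk]
      linarith
  -- conclusion
  rw [hqx x, htrace, ← hP x, Finset.mul_sum]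
  exact Finset.sum_le_sum fun i _ => by
    have := mul_le_mul_of_nonneg_right (hle i) (sq_nonneg ⟪b i, x⟫)
    linarith

/-- **Scaled rotation rigidity**: for a linear isometry `R`, `a, a' > 0` and an orthonormal triple `e` with
`∑ ‖a eⱼ − a' R eⱼ‖² < 4 a a'`, `‖a x − a' R x‖² ≤ ½ (∑ ‖a eⱼ − a' R eⱼ‖²) ‖x‖²`
(`‖a v − a' R v‖² = (a − a')² ‖v‖² + a a' ‖v − R v‖²`). [folklore] -/
theorem norm_sub_smul_isometry_sq_le (hn : Module.finrank ℝ E = 3) (R : E ≃ₗᵢ[ℝ] E) {a a' : ℝ} (ha : 0 < a)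
    (ha' : 0 < a') {e : Fin 3 → E} (he : Orthonormal ℝ e) (h4 : ∑ j, ‖a • e j - a' • R (e j)‖ ^ 2 < 4 * a * a')
    (x : E) : ‖a • x - a' • R x‖ ^ 2 ≤ (1 / 2) * (∑ j, ‖a • e j - a' • R (e j)‖ ^ 2) * ‖x‖ ^ 2 := by
  have hM : ∀ v, ‖a • v - a' • R v‖ ^ 2 = (a - a') ^ 2 * ‖v‖ ^ 2 + a * a' * ‖v - R v‖ ^ 2 := by
    intro v
    rw [norm_sub_sq_real, norm_sub_sq_real, norm_smul, norm_smul, LinearIsometryEquiv.norm_map,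
      real_inner_smul_left, real_inner_smul_right, Real.norm_of_nonneg ha.le, Real.norm_of_nonneg ha'.le]
    ring
  have hsum : ∑ j, ‖a • e j - a' • R (e j)‖ ^ 2 = 3 * (a - a') ^ 2 + a * a' * ∑ j, ‖e j - R (e j)‖ ^ 2 := by
    simp_rw [hM, he.1, one_pow, mul_one]
    rw [Fin.sum_univ_three, Fin.sum_univ_three]
    ring
  have haa : 0 < a * a' := mul_pos ha ha'
  have h4' : ∑ j, ‖e j - R (e j)‖ ^ 2 < 4 := by
    by_contra hge
    rw [not_lt] at hge
    have : 4 * a * a' ≤ ∑ j, ‖a • e j - a' • R (e j)‖ ^ 2 := by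
      rw [hsum]; nlinarith [sq_nonneg (a - a')]
    linarith
  have hcore := mul_le_mul_of_nonneg_left (norm_sub_isometry_sq_le hn R he h4' x) haa.le
  rw [hM, hsum]
  nlinarith [hcore, mul_nonneg (sq_nonneg (a - a')) (sq_nonneg ‖x‖)]

/-! ## The frame difference `v ↦ a • A v − s • (a' • A' v)` of two frames -/

/-- The frame difference is homogeneous. [folklore] -/
theorem frame_smul (A A' : E ≃ₗᵢ[ℝ] E) (s a a' c : ℝ) (f : E) :
    a • A (c • f) - s • (a' • A' (c • f)) = c • (a • A f - s • (a' • A' f)) := by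
  rw [LinearIsometryEquiv.map_smul, LinearIsometryEquiv.map_smul]
  module

/-- The frame difference is additive. [folklore] -/
theorem frame_sub (A A' : E ≃ₗᵢ[ℝ] E) (s a a' : ℝ) (f g : E) :
    a • A (f - g) - s • (a' • A' (f - g)) = (a • A f - s • (a' • A' f)) - (a • A g - s • (a' • A' g)) := by
  rw [LinearIsometryEquiv.map_sub, LinearIsometryEquiv.map_sub]
  module

/-- **Two frames** (dimension `3`): for `s = ±1`, `a, a' > 0` and an orthonormal triple `e` with
`∑ ‖a A eⱼ − s a' A' eⱼ‖² < 4 a a'`, `‖a A x − s a' A' x‖² ≤ ½ (∑ ‖a A eⱼ − s a' A' eⱼ‖²) ‖x‖²` —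
`‖a A v − s a' A' v‖ = ‖a v − a' R v‖` for the isometry `R = s A⁻¹ A'`. [folklore] -/
theorem two_frames_sq_le (hn : Module.finrank ℝ E = 3) (A A' : E ≃ₗᵢ[ℝ] E) {s a a' : ℝ} (hs : s = 1 ∨ s = -1)
    (ha : 0 < a) (ha' : 0 < a') {e : Fin 3 → E} (he : Orthonormal ℝ e)
    (h4 : ∑ j, ‖a • A (e j) - s • (a' • A' (e j))‖ ^ 2 < 4 * a * a') (x : E) :
    ‖a • A x - s • (a' • A' x)‖ ^ 2 ≤ (1 / 2) * (∑ j, ‖a • A (e j) - s • (a' • A' (e j))‖ ^ 2) * ‖x‖ ^ 2 := by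
  obtain ⟨R, hR⟩ : ∃ R : E ≃ₗᵢ[ℝ] E, ∀ v, A (R v) = s • A' v := by
    rcases hs with rfl | rfl
    · exact ⟨A'.trans A.symm, fun v => by simp⟩
    · exact ⟨(A'.trans A.symm).trans (LinearIsometryEquiv.neg ℝ), fun v => by simp⟩
  have hL : ∀ v, ‖a • A v - s • (a' • A' v)‖ = ‖a • v - a' • R v‖ := by
    intro v
    have h : a • A v - s • (a' • A' v) = A (a • v - a' • R v) := by
      rw [LinearIsometryEquiv.map_sub, LinearIsometryEquiv.map_smul, LinearIsometryEquiv.map_smul, hR,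
        smul_comm a' s]
    rw [h, LinearIsometryEquiv.norm_map]
  simp_rw [hL] at h4 ⊢
  exact norm_sub_smul_isometry_sq_le hn R ha ha' he h4 x

/-- **Two frames, orthogonal triple**: the same with an orthogonal triple `f₁, f₂, f₃` of square norms
`N₁, N₂, N₃ > 0` in place of an orthonormal one (each `‖·‖²` divided by `Nⱼ`). [folklore] -/
theorem two_frames_sq_le_of_orthogonal (hn : Module.finrank ℝ E = 3) (A A' : E ≃ₗᵢ[ℝ] E) {s a a' : ℝ}
    (hs : s = 1 ∨ s = -1) (ha : 0 < a) (ha' : 0 < a') {f₁ f₂ f₃ : E} {N₁ N₂ N₃ : ℝ} (hN₁ : 0 < N₁) (hN₂ : 0 < N₂)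
    (hN₃ : 0 < N₃) (h₁₁ : ⟪f₁, f₁⟫ = N₁) (h₂₂ : ⟪f₂, f₂⟫ = N₂) (h₃₃ : ⟪f₃, f₃⟫ = N₃) (h₁₂ : ⟪f₁, f₂⟫ = 0)
    (h₁₃ : ⟪f₁, f₃⟫ = 0) (h₂₃ : ⟪f₂, f₃⟫ = 0)
    (h4 : ‖a • A f₁ - s • (a' • A' f₁)‖ ^ 2 / N₁ + ‖a • A f₂ - s • (a' • A' f₂)‖ ^ 2 / N₂ +
      ‖a • A f₃ - s • (a' • A' f₃)‖ ^ 2 / N₃ < 4 * a * a') (x : E) :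
    ‖a • A x - s • (a' • A' x)‖ ^ 2 ≤ (1 / 2) * (‖a • A f₁ - s • (a' • A' f₁)‖ ^ 2 / N₁ +
      ‖a • A f₂ - s • (a' • A' f₂)‖ ^ 2 / N₂ + ‖a • A f₃ - s • (a' • A' f₃)‖ ^ 2 / N₃) * ‖x‖ ^ 2 := by
  have h₂₁ : ⟪f₂, f₁⟫ = 0 := by rw [real_inner_comm]; exact h₁₂
  have h₃₁ : ⟪f₃, f₁⟫ = 0 := by rw [real_inner_comm]; exact h₁₃
  have h₃₂ : ⟪f₃, f₂⟫ = 0 := by rw [real_inner_comm]; exact h₂₃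
  have key : ∀ {f : E} {N : ℝ}, 0 < N → ⟪f, f⟫ = N → ‖(Real.sqrt N)⁻¹ • f‖ = 1 ∧
      ‖a • A ((Real.sqrt N)⁻¹ • f) - s • (a' • A' ((Real.sqrt N)⁻¹ • f))‖ ^ 2 =
        ‖a • A f - s • (a' • A' f)‖ ^ 2 / N := by
    intro f N hN hf
    constructor
    · have hnf : ‖f‖ = Real.sqrt N := by
        rw [← hf, real_inner_self_eq_norm_sq, Real.sqrt_sq (norm_nonneg f)]
      rw [norm_smul, norm_inv, Real.norm_of_nonneg (Real.sqrt_nonneg _), hnf,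
        inv_mul_cancel₀ (Real.sqrt_pos.2 hN).ne']
    · rw [frame_smul, norm_smul, norm_inv, Real.norm_of_nonneg (Real.sqrt_nonneg _), mul_pow, inv_pow,
        Real.sq_sqrt hN.le, div_eq_inv_mul]
  obtain ⟨k₁, e₁⟩ := key hN₁ h₁₁
  obtain ⟨k₂, e₂⟩ := key hN₂ h₂₂
  obtain ⟨k₃, e₃⟩ := key hN₃ h₃₃
  set e : Fin 3 → E := ![(Real.sqrt N₁)⁻¹ • f₁, (Real.sqrt N₂)⁻¹ • f₂, (Real.sqrt N₃)⁻¹ • f₃] with hedef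
  have he : Orthonormal ℝ e := by
    refine ⟨fun i => ?_, fun i j hij => ?_⟩
    · fin_cases i
      · exact k₁
      · exact k₂
      · exact k₃
    · fin_cases i <;> fin_cases j <;>
        simp only [hedef, Fin.zero_eta, Fin.mk_one, Fin.reduceFinMk, Matrix.cons_val_zero, Matrix.cons_val_one,
          Matrix.cons_val] at hij ⊢ <;>
        first
        | exact absurd rfl hij
        | (rw [real_inner_smul_left, real_inner_smul_right]
           simp only [h₁₂, h₁₃, h₂₃, h₂₁, h₃₁, h₃₂, mul_zero])
  have hsum : ∑ j, ‖a • A (e j) - s • (a' • A' (e j))‖ ^ 2 = ‖a • A f₁ - s • (a' • A' f₁)‖ ^ 2 / N₁ +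
      ‖a • A f₂ - s • (a' • A' f₂)‖ ^ 2 / N₂ + ‖a • A f₃ - s • (a' • A' f₃)‖ ^ 2 / N₃ := by
    rw [Fin.sum_univ_three]
    simp only [hedef, Matrix.cons_val_zero, Matrix.cons_val_one, Matrix.cons_val]
    rw [e₁, e₂, e₃]
  have h := two_frames_sq_le hn A A' hs ha ha' he (by rw [hsum]; exact h4) x
  rwa [hsum] at h

/-- The bond: `‖x − a A p‖ ≤ a/100` and `‖x − s a' A' p‖ ≤ a'/100` give `‖a A p − s a' A' p‖ ≤ (a + a')/100`.
[folklore] -/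
theorem frame_le_of_near {A A' : E ≃ₗᵢ[ℝ] E} {s a a' : ℝ} {x p : E} (h1 : ‖x - a • A p‖ ≤ a / 100)
    (h2 : ‖x - s • (a' • A' p)‖ ≤ a' / 100) : ‖a • A p - s • (a' • A' p)‖ ≤ a / 100 + a' / 100 := by
  have h : a • A p - s • (a' • A' p) = (x - s • (a' • A' p)) - (x - a • A p) := by abel
  rw [h]
  linarith [norm_sub_le (x - s • (a' • A' p)) (x - a • A p)]

/-- A common neighbour: `‖y − a A q‖, ‖x − a A p‖ ≤ a/100` and `‖(y − x) − s a' A' (q − p)‖ ≤ a'/100` give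
`‖a A (q − p) − s a' A' (q − p)‖ ≤ (2a + a')/100`. [folklore] -/
theorem frame_sub_le_of_near {A A' : E ≃ₗᵢ[ℝ] E} {s a a' : ℝ} {x y p q : E} (hy : ‖y - a • A q‖ ≤ a / 100)
    (hx : ‖x - a • A p‖ ≤ a / 100) (hyx : ‖(y - x) - s • (a' • A' (q - p))‖ ≤ a' / 100) :
    ‖a • A (q - p) - s • (a' • A' (q - p))‖ ≤ a / 100 + a / 100 + a' / 100 := by
  have h : a • A (q - p) - s • (a' • A' (q - p)) =
      ((y - x) - s • (a' • A' (q - p))) - (y - a • A q) + (x - a • A p) := by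
    rw [LinearIsometryEquiv.map_sub, smul_sub]; abel
  rw [h]
  calc ‖((y - x) - s • (a' • A' (q - p))) - (y - a • A q) + (x - a • A p)‖
      ≤ ‖((y - x) - s • (a' • A' (q - p))) - (y - a • A q)‖ + ‖x - a • A p‖ := norm_add_le _ _
    _ ≤ ‖(y - x) - s • (a' • A' (q - p))‖ + ‖y - a • A q‖ + ‖x - a • A p‖ := by
        gcongr; exact norm_sub_le _ _
    _ ≤ a / 100 + a / 100 + a' / 100 := by linarith

/-- The two scales differ by at most `(a + a')/100`: the bond has length within `a/100` of `a` and within `a'/100`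
of `a'`. [folklore] -/
theorem abs_sub_le_of_near {A A' : E ≃ₗᵢ[ℝ] E} {s a a' : ℝ} (hs : s = 1 ∨ s = -1) (ha : 0 ≤ a) (ha' : 0 ≤ a')
    {x p : E} (hp : ‖p‖ = 1) (h1 : ‖x - a • A p‖ ≤ a / 100) (h2 : ‖x - s • (a' • A' p)‖ ≤ a' / 100) :
    |a - a'| ≤ a / 100 + a' / 100 := by
  have hs1 : |s| = 1 := by rcases hs with rfl | rfl <;> simp
  have n1 : ‖a • A p‖ = a := by rw [norm_smul, LinearIsometryEquiv.norm_map, hp, mul_one, Real.norm_of_nonneg ha]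
  have n2 : ‖s • (a' • A' p)‖ = a' := by
    rw [norm_smul, norm_smul, LinearIsometryEquiv.norm_map, hp, mul_one, Real.norm_eq_abs, hs1, one_mul,
      Real.norm_of_nonneg ha']
  have e1 : |‖x‖ - a| ≤ a / 100 := by
    have h := abs_norm_sub_norm_le x (a • A p)
    rw [n1] at h
    exact h.trans h1
  have e2 : |‖x‖ - a'| ≤ a' / 100 := by
    have h := abs_norm_sub_norm_le x (s • (a' • A' p))
    rw [n2] at h
    exact h.trans h2
  rw [abs_le] at e1 e2 ⊢
  constructor <;> linarith [e1.1, e1.2, e2.1, e2.2]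

/-- **Registered anchor `tube_frameRigidity` (two frames of `ℝ³` agree everywhere once they agree on an orthonormal
triple, with the rotation constant `½`).**  For linear isometries `A, A'` of `ℝ³`, a sign `s = ±1`, scales
`a, a' > 0` and an orthonormal triple `e` with `∑ ‖a A eⱼ − s a' A' eⱼ‖² < 4 a a'`:
`‖a A x − s a' A' x‖² ≤ ½ (∑ ‖a A eⱼ − s a' A' eⱼ‖²) ‖x‖²` for all `x`. [folklore] -/
theorem tube_frameRigidity : ∀ (A A' : EuclideanSpace ℝ (Fin 3) ≃ₗᵢ[ℝ] EuclideanSpace ℝ (Fin 3)) (s a a' : ℝ), (s = 1 ∨ s = -1) → 0 < a → 0 < a' → ∀ e : Fin 3 → EuclideanSpace ℝ (Fin 3), Orthonormal ℝ e → ∑ j, ‖a • A (e j) - s • (a' • A' (e j))‖ ^ 2 < 4 * a * a' → ∀ x : EuclideanSpace ℝ (Fin 3), ‖a • A x - s • (a' • A' x)‖ ^ 2 ≤ (1 / 2) * (∑ j, ‖a • A (e j) - s • (a' • A' (e j))‖ ^ 2) * ‖x‖ ^ 2 :=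
  fun A A' _ _ _ hs ha ha' _ he h4 x => two_frames_sq_le finrank_euclideanSpace_fin A A' hs ha ha' he h4 x

end Summit.AtomisticToContinuum.Crystallization.Theorems.PalmUnimodularRigidity.LayeredLawsSelectHcp

end
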